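import Summits.QuantumFields.YangMills.Theorems.BalabanUVNodesN15KingModelBoxShiftedHalfGrids
import HarnessLib

/-!
# BalabanUVNodes ∕ N15 — THE KING-MODEL RUNG (PART Ϟ-f): THE THERMODYNAMIC LIMIT OF THE FREE ENERGY DENSITY WITH FREE BOUNDARY CONDITIONS —
# `|Ω_j|⁻¹·ln det(c(−Δ_free)+m²)_{Ω_j} → kingFreeEnergyInf c m² d` along ANY boxes with all sides `→ ∞`: THE SAME LIMIT AS WITH PERIODIC BOUNDARY CONDITIONS (part Ε-m);
# by-product `kingFreeEnergyInf c m² d = π^{−(d+1)}∫_{[0,π]^{d+1}} ln(m² + cΣ_μ(2−2cos p_μ))dp`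
# (Track A, DAG node N15 = NE2; FAN-OUT v1.1 §N15 s3 «KING-MODEL RUNG»; King p.670 l.8–13 «free boundary conditions»; count-neutral)

HONEST FRAMING.  Count-neutral (cell `pub-ymgap`, seat `pub-ymgap-dag-n15-e` g41; `--supports stmt-QuantumFields-27366 --as helper` = K3⁸).
TEMPLATE LITERATURE: C. King, Commun. Math. Phys. **102** (1986) 649–677 [King1986]: (3.89)–(3.93) pp.668–669, §4 p.670 l.8–13, (4.4) p.670.  Part Ε-m (g40): the periodic
thermodynamic limit `|T|⁻¹Σ_q ln lapSym(q) → kingFreeEnergyInf` along any tori; part Ϟ-e: the doubled torus's dual is tiled by the `2^{d+1}` shifted half grids and each shifted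
half-grid sum `→ π^{−(d+1)}·halfZoneIntegral`.  THIS FILE closes the argument: ★★ **`tendsto_sum_log_lapSym_dblTorus_div_card`** (the doubled-torus density
`= 2^{−(d+1)}Σ_S(Πn_j)⁻¹boxLogSymSum S → π^{−(d+1)}halfZoneIntegral`), ★★★ **`kingFreeEnergyInf_eq_halfZoneIntegral`** (`kingFreeEnergyInf c m² d = π^{−(d+1)}∫_{[0,π]^{d+1}}
ln(m²+cΣ(2−2cos p_μ))dp` — by uniqueness of limits against Ε-m along the doubled cubes; the coordinatewise EVENNESS of the zone integral obtained through Riemann sums, with no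
change of variables), ★★★ **`tendsto_log_det_boxOp_div_card`** (THE FREE-BOUNDARY FREE ENERGY DENSITY CONVERGES TO THE PERIODIC ONE: `|Ω_j|⁻¹ln det(c(−Δ_free)+m²)_{Ω_j} →
kingFreeEnergyInf c m² d` along ANY boxes with all sides `→ ∞`), ★★ **`tendsto_log_gaussNorm_boxOp_div_card`** (`|Ω_j|⁻¹ln 𝒩((c(−Δ_free)+m²)_{Ω_j}) → ½ln 2π − ½kingFreeEnergyInf`).

PRIOR TREE ART (named, USED not restated): Ϟ-e (`boxLogSymSum`, `halfZoneIntegral`, `tendsto_boxLogSymSum_div`, `sum_log_lapSym_dblTorus_eq`, `log_det_boxOp_eq_boxLogSymSum`,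
`card_kingBox`), Ϟ-c (`log_det_boxOp`, `log_gaussNorm_boxOp`), Ν-b (`card_dblTorus_eq`), Ε-m (`kingFreeEnergyInf`, `tendsto_sum_log_lapSym_div_card`).  NOT Bałaban's covariant
objects; NOT a node discharge (N15 is booked through n15-a's knit, untouched); nothing continuum-YM ∕ `ℝ⁴` ∕ OS ∕ Clay.  0 `sorry`; 0 `def`.

HONEST SCOPE.  King's `A = 0` free operator `c(−Δ)+m²` (`c ≥ 0`, `m² > 0`) on boxes `Ω_j = Π_μ{0,…,n_{j,μ}−1}` with all `n_{j,μ} → ∞`; the RG block-field operator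
`Δ^{(K)}_Ω`'s density limit (which needs the coordinatewise reflection symmetry of King's alias symbol (4.5)) is NOT here.  No rate of convergence is claimed (the boundary
contribution is `O(Σ_μ 1∕n_{j,μ})` but is not quantified here).  Locators: [King1986] (3.89)–(3.93) pp.668–669, §4 p.670 l.8–13, (4.4) p.670.
-/

noncomputable section

open scoped BigOperators Topology
open Finset Filter MeasureTheory

namespace Summit.QuantumFields.YangMills.BalabanUVNodes.N15KingModelRung.TorusSpectral

open Literature.MathematicalPhysics.QuantumFieldTheory.Balaban1983to89.B5Prop11Plancherel (Tor sOf)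
open Literature.MathematicalPhysics.QuantumFieldTheory.King1986.Torus
open Summit.QuantumFields.YangMills.BalabanUVNodes.N15KingModelRung.FreeField (gaussNorm)

variable {d : ℕ}

/-! ## §3 Identification with the periodic limit; the free-boundary free energy density -/

section Limit

variable {c m2 : ℝ}

/-- ★★ **THE DOUBLED-TORUS DENSITY THROUGH THE HALF GRIDS**: along any boxes with all sides `→ ∞`, `|T̂(2n_j)|⁻¹Σ_{q}ln lapSym(2n_j)(q) = 2^{−(d+1)}Σ_S(Πn_j)⁻¹boxLogSymSum S →
π^{−(d+1)}·halfZoneIntegral`. [cite: King1986, (3.89)–(3.93) pp.668–669, (4.4) p.670] -/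
theorem tendsto_sum_log_lapSym_dblTorus_div_card (hc : 0 ≤ c) (hm : 0 < m2) (nseq : ℕ → Fin (d + 1) → ℕ) (hpos : ∀ j ν, 0 < nseq j ν)
    (hlim : ∀ ν, Tendsto (fun j => (nseq j ν : ℝ)) atTop atTop) :
    Tendsto (fun j => haveI : ∀ ν, NeZero (nseq j ν) := fun ν => ⟨(hpos j ν).ne'⟩
      (Fintype.card (Tor (dblPer (nseq j))) : ℝ)⁻¹ * ∑ q : Tor (dblPer (nseq j)), Real.log (lapSym (dblPer (nseq j)) c m2 q)) atTop
      (𝓝 ((Real.pi ^ (d + 1))⁻¹ * halfZoneIntegral c m2 d)) := by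
  have hS := tendsto_finsetSum (Finset.univ : Finset (Finset (Fin (d + 1)))) fun S _ => tendsto_boxLogSymSum_div hc hm S nseq hpos hlim
  rw [Finset.sum_const, Finset.card_univ, Fintype.card_finset, Fintype.card_fin, nsmul_eq_mul] at hS
  have h2 : ((2 : ℝ) ^ (d + 1))⁻¹ * ((2 ^ (d + 1) : ℕ) * ((Real.pi ^ (d + 1))⁻¹ * halfZoneIntegral c m2 d)) = (Real.pi ^ (d + 1))⁻¹ * halfZoneIntegral c m2 d := by
    push_cast
    rw [← mul_assoc, inv_mul_cancel₀ (pow_ne_zero _ two_ne_zero), one_mul]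
  rw [← h2]
  refine (hS.const_mul (((2 : ℝ) ^ (d + 1))⁻¹)).congr fun j => ?_
  haveI : ∀ ν, NeZero (nseq j ν) := fun ν => ⟨(hpos j ν).ne'⟩
  rw [card_dblTorus_eq (nseq j), card_kingBox, sum_log_lapSym_dblTorus_eq (nseq j) c m2, Finset.mul_sum, Finset.mul_sum]
  refine Finset.sum_congr rfl fun S _ => ?_
  push_cast
  rw [mul_inv, mul_assoc]

/-- ★★★ **THE INFINITE-VOLUME FREE ENERGY DENSITY AS A HALF-ZONE INTEGRAL**: `kingFreeEnergyInf c m² d = π^{−(d+1)}·∫_{[0,π]^{d+1}} ln(m² + cΣ_μ(2−2cos p_μ))dp` (`c ≥ 0`, `m² > 0`)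
— identified by uniqueness of limits: Ε-m's periodic limit along the doubled cubes `(ℤ∕2(j+1))^{d+1}` against §2. [cite: King1986, (3.89)–(3.93) pp.668–669, (4.4) p.670] -/
theorem kingFreeEnergyInf_eq_halfZoneIntegral (hc : 0 ≤ c) (hm : 0 < m2) :
    kingFreeEnergyInf c m2 d = (Real.pi ^ (d + 1))⁻¹ * halfZoneIntegral c m2 d := by
  set nseq : ℕ → Fin (d + 1) → ℕ := fun j _ => j + 1 with hnseq
  have hpos : ∀ j ν, 0 < nseq j ν := fun j _ => Nat.succ_pos j
  have hlim : ∀ ν, Tendsto (fun j => (nseq j ν : ℝ)) atTop atTop := fun ν => by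
    have : Tendsto (fun j : ℕ => ((j : ℝ) + 1)) atTop atTop := tendsto_atTop_add_const_right _ 1 tendsto_natCast_atTop_atTop
    refine this.congr fun j => ?_
    simp only [hnseq]; push_cast; ring
  have h1 := tendsto_sum_log_lapSym_dblTorus_div_card hc hm nseq hpos hlim
  have h2 := tendsto_sum_log_lapSym_div_card (d := d) hc hm (fun j => dblPer (nseq j)) (fun j ν => by simp only [dblPer]; exact Nat.mul_pos two_pos (hpos j ν))
    (fun ν => by
      have : Tendsto (fun j => (2 : ℝ) * (nseq j ν : ℝ)) atTop atTop := (hlim ν).const_mul_atTop two_pos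
      refine this.congr fun j => ?_
      simp only [dblPer]; push_cast; ring)
  exact tendsto_nhds_unique h2 h1

/-- ★★★ **THE FREE ENERGY DENSITY WITH FREE BOUNDARY CONDITIONS HAS THE SAME THERMODYNAMIC LIMIT AS WITH PERIODIC ONES**: along ANY boxes `Ω_j = Π_μ{0,…,n_{j,μ}−1}` with every
`n_{j,μ} → ∞` (`≥ 1`), for `c ≥ 0`, `m² > 0`: `|Ω_j|⁻¹·ln det(c(−Δ_free)+m²)_{Ω_j} → kingFreeEnergyInf c m² d` (the limit of part Ε-m along tori). [cite: King1986, (3.89)–(3.93) pp.668–669,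
§4 p.670 l.8–13, (4.4) p.670] -/
theorem tendsto_log_det_boxOp_div_card (hc : 0 ≤ c) (hm : 0 < m2) (nseq : ℕ → Fin (d + 1) → ℕ) (hpos : ∀ j ν, 0 < nseq j ν)
    (hlim : ∀ ν, Tendsto (fun j => (nseq j ν : ℝ)) atTop atTop) :
    Tendsto (fun j => haveI : ∀ ν, NeZero (nseq j ν) := fun ν => ⟨(hpos j ν).ne'⟩
      (Fintype.card (KingBox (nseq j)) : ℝ)⁻¹ * Real.log (boxOp (nseq j) c m2).det) atTop (𝓝 (kingFreeEnergyInf c m2 d)) := by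
  rw [kingFreeEnergyInf_eq_halfZoneIntegral hc hm]
  refine (tendsto_boxLogSymSum_div hc hm ∅ nseq hpos hlim).congr fun j => ?_
  haveI : ∀ ν, NeZero (nseq j ν) := fun ν => ⟨(hpos j ν).ne'⟩
  rw [card_kingBox, log_det_boxOp_eq_boxLogSymSum (nseq j) hc hm]
  norm_cast

/-- ★★ **THE FREE-FIELD NORMALISATION PER SITE WITH FREE BOUNDARY CONDITIONS**: `|Ω_j|⁻¹·ln 𝒩((c(−Δ_free)+m²)_{Ω_j}) → ½ln 2π − ½·kingFreeEnergyInf c m² d` — the same limit as on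
tori. [cite: King1986, (3.89)–(3.93) pp.668–669, (2.6) p.652, §4 p.670] -/
theorem tendsto_log_gaussNorm_boxOp_div_card (hc : 0 ≤ c) (hm : 0 < m2) (nseq : ℕ → Fin (d + 1) → ℕ) (hpos : ∀ j ν, 0 < nseq j ν)
    (hlim : ∀ ν, Tendsto (fun j => (nseq j ν : ℝ)) atTop atTop) :
    Tendsto (fun j => haveI : ∀ ν, NeZero (nseq j ν) := fun ν => ⟨(hpos j ν).ne'⟩
      (Fintype.card (KingBox (nseq j)) : ℝ)⁻¹ * Real.log (gaussNorm (boxOp (nseq j) c m2))) atTop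
      (𝓝 (1 / 2 * Real.log (2 * Real.pi) - 1 / 2 * kingFreeEnergyInf c m2 d)) := by
  have h := tendsto_log_det_boxOp_div_card hc hm nseq hpos hlim
  have h' := (tendsto_const_nhds (x := 1 / 2 * Real.log (2 * Real.pi))).sub (h.const_mul (1 / 2))
  refine h'.congr fun j => ?_
  haveI : ∀ ν, NeZero (nseq j ν) := fun ν => ⟨(hpos j ν).ne'⟩
  have hcard : (Fintype.card (KingBox (nseq j)) : ℝ) ≠ 0 := by exact_mod_cast Fintype.card_ne_zero
  rw [log_gaussNorm_boxOp (nseq j) hc hm, ← log_det_boxOp (nseq j) hc hm, mul_sub,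
    show ((Fintype.card (KingBox (nseq j)) : ℝ))⁻¹ * ((Fintype.card (KingBox (nseq j)) : ℝ) / 2 * Real.log (2 * Real.pi)) = 1 / 2 * Real.log (2 * Real.pi) by
      rw [div_eq_mul_inv, ← mul_assoc, ← mul_assoc, inv_mul_cancel₀ hcard, one_mul]; ring]
  ring

end Limit

end Summit.QuantumFields.YangMills.BalabanUVNodes.N15KingModelRung.TorusSpectral

end
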